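import Literature.NumberTheory.GaloisRepresentations.LiftingRingRigidity
import Literature.NumberTheory.GaloisRepresentations.CrystallineDeformationRingSmooth
import HarnessLib

/-!
# Kisin's generic-fibre predicate is a statement about ONE ring per residual representation

The accepted predicate `PstWeilDeligneData.CrystallineGenericFibreRegular 𝔇` (Kisin, Thm.
(3.3.8), in the formulation of `CrystallineDeformationRingSmooth`) quantifies over EVERY instance
`𝓡 : CrystallineDeformationRing p K 𝒪_L k_L ρ̄ 𝔇 (𝔇.HasHodgeType v)` of the interface, whereas
the printed theorem concerns the one ring `(R^□_{V_𝔽}[1/p])^{v}_{cr}`. By the accepted rigidity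
theorem `PointwiseLiftingRing.algEquiv` (file `LiftingRingRigidity`: [BLGGT] §1.4 "uniquely
characterized" — any two instances over `𝒪_L` are `𝒪_L`-isomorphic compatibly with their
liftings) the two readings agree. This file records the consumable form:

* `PstWeilDeligneData.crystallineGenericFibreRegular_of_exists` — to prove
  `CrystallineGenericFibreRegular 𝔇` it suffices, for every `L ⊇ τ(K)`, `n`, `ρ̄`, `v` for which
  an instance exists at all, to exhibit ONE instance whose generic fibre `R[1/p]` is regular with
  all irreducible components of dimension `crystallineGenericFibreDim 𝔇 n v`;
* `PstWeilDeligneData.crystallineGenericFibreRegular_iff_exists` — the equivalence.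

No named facts, no `sorry`.

## References

* M. Kisin, *Potentially semi-stable deformation rings*, JAMS 21 (2008), Thm. (3.3.8). [Kisin2007]
* [BLGGT] T. Barnet-Lamb, T. Gee, D. Geraghty, R. Taylor, *Potential automorphy and change of
  weight*, Ann. of Math. 179 (2014), §1.4. [BarnetlambEtAl2014]
-/

noncomputable section

open Field IsLocalRing
open scoped MatrixGroups

namespace Literature.NumberTheory.GaloisRepresentations

namespace PstWeilDeligneData

variable {K : Type} [Field K] [ValuativeRel K] [TopologicalSpace K] [IsNonarchimedeanLocalField K]
  {p : ℕ} [Fact p.Prime]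

/-- **One good instance per `(L, n, ρ̄, v)` suffices for `CrystallineGenericFibreRegular`.** If for
every finite `L ⊇ τ(K)`, every `n`, `ρ̄ : Γ_K → GL_n(k_L)` and Hodge type `v` admitting a crystalline
deformation ring of type `v` at all there is SOME instance `𝓡₀` with `𝓡₀.R[1/p]` regular and
equidimensional of dimension `crystallineGenericFibreDim 𝔇 n v`, then EVERY instance has these
properties (rigidity, `PointwiseLiftingRing.genericFibre_transport`), i.e.
`𝔇.CrystallineGenericFibreRegular`. [cite: Kisin2007, Thm. 3.3.8] [cite: BarnetlambEtAl2014, §1.4] -/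
theorem crystallineGenericFibreRegular_of_exists (𝔇 : PstWeilDeligneData K p)
    (h : ∀ (L : IntermediateField ℚ_[p] (PadicAlgCl p)) [FiniteDimensional ℚ_[p] L],
      letI := 𝔇.algebra
      (∀ (τ : K →ₐ[ℚ_[p]] PadicAlgCl p) (a : K), τ a ∈ L) →
      ∀ (n : ℕ),
      letI := intermediateFieldIntegers.algebraPadicAlgCl L
      letI : TopologicalSpace (ResidueField (intermediateFieldIntegers p L)) := ⊥
      ∀ (ρbar : FramedRep (absoluteGaloisGroup K) (ResidueField (intermediateFieldIntegers p L)) n)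
        (v : (K →+* PadicAlgCl p) → Multiset ℤ),
        Nonempty (CrystallineDeformationRing p K (intermediateFieldIntegers p L)
          (ResidueField (intermediateFieldIntegers p L)) ρbar 𝔇 (𝔇.HasHodgeType v)) →
        ∃ 𝓡₀ : CrystallineDeformationRing p K (intermediateFieldIntegers p L)
          (ResidueField (intermediateFieldIntegers p L)) ρbar 𝔇 (𝔇.HasHodgeType v),
          IsRegularRing (Localization.Away (p : 𝓡₀.R)) ∧
            ∀ 𝔮 ∈ minimalPrimes (Localization.Away (p : 𝓡₀.R)),
              ringKrullDim (Localization.Away (p : 𝓡₀.R) ⧸ 𝔮) =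
                (𝔇.crystallineGenericFibreDim n v : ℕ)) :
    𝔇.CrystallineGenericFibreRegular := by
  intro L _ hL n
  letI := intermediateFieldIntegers.algebraPadicAlgCl L
  letI : TopologicalSpace (ResidueField (intermediateFieldIntegers p L)) := ⊥
  intro ρbar v 𝓡
  obtain ⟨𝓡₀, h₀⟩ := h L hL n ρbar v ⟨𝓡⟩
  haveI : IsScalarTower (intermediateFieldIntegers p L) L (PadicAlgCl p) :=
    IsScalarTower.of_algebraMap_eq fun _ => rfl
  haveI : Finite (ResidueField (intermediateFieldIntegers p L)) :=
    intermediateFieldIntegers.finite_residueField L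
  exact PointwiseLiftingRing.genericFibre_transport L 𝓡₀ 𝓡 IsLocalRing.residue_surjective h₀

/-- **`CrystallineGenericFibreRegular` ⇔ one good instance wherever an instance exists.**
[cite: Kisin2007, Thm. 3.3.8] [cite: BarnetlambEtAl2014, §1.4] -/
theorem crystallineGenericFibreRegular_iff_exists (𝔇 : PstWeilDeligneData K p) :
    𝔇.CrystallineGenericFibreRegular ↔
      ∀ (L : IntermediateField ℚ_[p] (PadicAlgCl p)) [FiniteDimensional ℚ_[p] L],
      letI := 𝔇.algebra
      (∀ (τ : K →ₐ[ℚ_[p]] PadicAlgCl p) (a : K), τ a ∈ L) →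
      ∀ (n : ℕ),
      letI := intermediateFieldIntegers.algebraPadicAlgCl L
      letI : TopologicalSpace (ResidueField (intermediateFieldIntegers p L)) := ⊥
      ∀ (ρbar : FramedRep (absoluteGaloisGroup K) (ResidueField (intermediateFieldIntegers p L)) n)
        (v : (K →+* PadicAlgCl p) → Multiset ℤ),
        Nonempty (CrystallineDeformationRing p K (intermediateFieldIntegers p L)
          (ResidueField (intermediateFieldIntegers p L)) ρbar 𝔇 (𝔇.HasHodgeType v)) →
        ∃ 𝓡₀ : CrystallineDeformationRing p K (intermediateFieldIntegers p L)
          (ResidueField (intermediateFieldIntegers p L)) ρbar 𝔇 (𝔇.HasHodgeType v),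
          IsRegularRing (Localization.Away (p : 𝓡₀.R)) ∧
            ∀ 𝔮 ∈ minimalPrimes (Localization.Away (p : 𝓡₀.R)),
              ringKrullDim (Localization.Away (p : 𝓡₀.R) ⧸ 𝔮) =
                (𝔇.crystallineGenericFibreDim n v : ℕ) := by
  refine ⟨fun h L _ hL n => ?_, 𝔇.crystallineGenericFibreRegular_of_exists⟩
  letI := intermediateFieldIntegers.algebraPadicAlgCl L
  letI : TopologicalSpace (ResidueField (intermediateFieldIntegers p L)) := ⊥
  rintro ρbar v ⟨𝓡⟩
  exact ⟨𝓡, h L hL n ρbar v 𝓡⟩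

end PstWeilDeligneData

end Literature.NumberTheory.GaloisRepresentations

end
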